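import Mathlib

/-!
# `DivisionGap.PerMultiplesHard` (stmt-ValiantsHypothesis-5068), line `uncharged-face-walk`:
stub `stub_codegreeMixing` — the Cauchy–Schwarz codegree criterion for lower mixing

A bipartite host `H ⊆ Fin a × Fin a` (rows = first coordinate, columns = second coordinate) whose
row degrees `deg x = #{y : (x, y) ∈ H}` deviate from `q a` by at most `η₁ a²` in `ℓ¹`, and whose
ordered-pair row codegrees `codeg x x' = #{y : (x, y) ∈ H ∧ (x', y) ∈ H}` (`x ≠ x'`) deviate from
`q² a` by at most `η₂ a³` in `ℓ¹`, satisfies the LOWER mixing bound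
`e_H(A, B) ≥ q #A #B − √(3 η₁ + η₂ + 1/a) · a²` for every row set `A` and column set `B`, where
`e_H(A, B) = #{e ∈ H : e.1 ∈ A, e.2 ∈ B}` (`stub_codegreeMixing`).  This is the standard
"codegree implies discrepancy" half of the Chung–Graham–Wilson equivalences, in the explicit
quantitative form the route needs.

Proof.  Put `u = #A`, `t = #B`, `μ = q u`, and for a column `b` let `d b = #{x ∈ A : (x, b) ∈ H}`.
Double counting gives `e_H(A, B) = ∑_{b ∈ B} d b` (`card_filter_rect_eq_sum_cols`), so
`μ t − e = ∑_{b ∈ B} (μ − d b)` and by Cauchy–Schwarz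
`(μ t − e)² ≤ t ∑_{b ∈ B} (μ − d b)² ≤ t ∑_b (μ − d b)² = t (a μ² − 2 μ D + Q)` with
`D = ∑_b d b = ∑_{x ∈ A} deg x` (`sum_colDegIn_eq_sum_deg`) and
`Q = ∑_b (d b)² = ∑_{x ∈ A} ∑_{x' ∈ A} codeg x x' = D + C`,
`C = ∑_{x ∈ A} ∑_{x' ∈ A, x' ≠ x} codeg x x'` (`sum_colDegIn_sq`, the diagonal terms being
`codeg x x = deg x`).  The hypotheses give `|D − q a u| ≤ η₁ a²` and `|C − q² a u (u − 1)| ≤ η₂ a³`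
(restrict the `ℓ¹` sums to `A`), and the exact identity
`a μ² − 2 μ D + D + C = q a u (1 − q) + (D − q a u)(1 − 2 q u) + (C − q² a u (u − 1))`
(the `u²` terms cancel) bounds the bracket by `a² + η₁ a² (1 + 2a) + η₂ a³ ≤ a² + (3 η₁ + η₂) a³`.
With `t ≤ a` this is `(μ t − e)² ≤ (3 η₁ + η₂ + 1/a) a⁴`, whence `μ t − e ≤ √(3 η₁ + η₂ + 1/a) a²`
(`codegree_mixing_arith`).  Elementary; no single source. [folklore]
-/

noncomputable section

-- `Summit.ValiantsHypothesis.ValiantsHypothesis.…` is the tree's mandated layout (Sub = Summit).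
set_option linter.dupNamespace false

open Finset
open scoped BigOperators

namespace Summit.ValiantsHypothesis.ValiantsHypothesis.Theorems.DivisionGap.PerMultiplesHard.CodegreeMixing

/-- Double counting over columns: the number of cells of `H` in the rectangle `A × B` is the sum
over the columns `b ∈ B` of the number of rows `x ∈ A` with `(x, b) ∈ H`. [folklore] -/
theorem card_filter_rect_eq_sum_cols {a : ℕ} (H : Finset (Fin a × Fin a))
    (A B : Finset (Fin a)) :
    (H.filter fun e => e.1 ∈ A ∧ e.2 ∈ B).card =
      ∑ b ∈ B, (A.filter fun x => (x, b) ∈ H).card := by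
  -- adapted from `RegularPairFactor.card_filter_rect_eq_sum_cols`
  have h1 : (H.filter fun e => e.1 ∈ A ∧ e.2 ∈ B) = (A ×ˢ B).filter (fun e => e ∈ H) := by
    ext e
    simp only [Finset.mem_filter, Finset.mem_product]
    tauto
  rw [h1, Finset.card_filter, Finset.sum_product_right]
  simp only [Finset.card_filter]

/-- Double counting over rows: the number of cells of `H` in the rectangle `A × B` is the sum
over the rows `x ∈ A` of the number of columns `y ∈ B` with `(x, y) ∈ H`. [folklore] -/
theorem card_filter_rect_eq_sum_rows {a : ℕ} (H : Finset (Fin a × Fin a))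
    (A B : Finset (Fin a)) :
    (H.filter fun e => e.1 ∈ A ∧ e.2 ∈ B).card =
      ∑ x ∈ A, (B.filter fun y => (x, y) ∈ H).card := by
  -- adapted from `RegularPairFactor.card_filter_rect_eq_sum_rows`
  have h1 : (H.filter fun e => e.1 ∈ A ∧ e.2 ∈ B) = (A ×ˢ B).filter (fun e => e ∈ H) := by
    ext e
    simp only [Finset.mem_filter, Finset.mem_product]
    tauto
  rw [h1, Finset.card_filter, Finset.sum_product]
  simp only [Finset.card_filter]

/-- Swapping the order of summation: the sum over all columns `b` of the degree of `b` into the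
row set `A` equals the sum over `x ∈ A` of the (full) row degree of `x`; both count the cells of
`H` with row in `A`. [folklore] -/
theorem sum_colDegIn_eq_sum_deg {a : ℕ} (H : Finset (Fin a × Fin a)) (A : Finset (Fin a)) :
    ∑ b : Fin a, (A.filter fun x => (x, b) ∈ H).card =
      ∑ x ∈ A, (Finset.univ.filter fun y : Fin a => (x, y) ∈ H).card := by
  rw [← card_filter_rect_eq_sum_cols H A Finset.univ, card_filter_rect_eq_sum_rows H A Finset.univ]

/-- The second moment of the column degrees into `A` is a codegree sum,
`∑_b d_A(b)² = ∑_{x ∈ A} ∑_{x' ∈ A} codeg (x, x')`; splitting off the diagonal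
`codeg (x, x) = deg x` gives
`∑_b d_A(b)² = ∑_{x ∈ A} deg x + ∑_{x ∈ A} ∑_{x' ∈ A, x' ≠ x} codeg (x, x')`. [folklore] -/
theorem sum_colDegIn_sq {a : ℕ} (H : Finset (Fin a × Fin a)) (A : Finset (Fin a)) :
    ∑ b : Fin a, (A.filter fun x => (x, b) ∈ H).card ^ 2 =
      ∑ x ∈ A, (Finset.univ.filter fun y : Fin a => (x, y) ∈ H).card +
        ∑ x ∈ A, ∑ x' ∈ A.erase x,
          (Finset.univ.filter fun y : Fin a => (x, y) ∈ H ∧ (x', y) ∈ H).card := by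
  -- first: `∑_b d_A(b)² = ∑_{x ∈ A} ∑_{x' ∈ A} codeg (x, x')`
  have h1 : ∑ b : Fin a, (A.filter fun x => (x, b) ∈ H).card ^ 2 =
      ∑ x ∈ A, ∑ x' ∈ A, (Finset.univ.filter fun y : Fin a => (x, y) ∈ H ∧ (x', y) ∈ H).card := by
    simp only [Finset.card_filter, sq, Finset.sum_mul_sum, ite_zero_mul_ite_zero, mul_one]
    rw [Finset.sum_comm]
    refine Finset.sum_congr rfl fun x _ => ?_
    rw [Finset.sum_comm]
  rw [h1, ← Finset.sum_add_distrib]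
  refine Finset.sum_congr rfl fun x hx => ?_
  rw [← Finset.add_sum_erase A _ hx]
  simp only [and_self]

/-- The real-arithmetic core.  With `1 ≤ a`, `0 ≤ q ≤ 1`, `0 ≤ u, t ≤ a`, `|D − q a u| ≤ η₁ a²`,
`|C − q² a u (u − 1)| ≤ η₂ a³` and the Cauchy–Schwarz estimate
`(q u t − e)² ≤ t (a (q u)² − 2 (q u) D + (D + C))`, one has `q u t − √(3 η₁ + η₂ + 1/a) a² ≤ e`:
the bracket equals `q a u (1 − q) + (D − q a u)(1 − 2 q u) + (C − q² a u (u − 1))`, which is at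
most `a² + (3 η₁ + η₂) a³`, so `(q u t − e)² ≤ (3 η₁ + η₂ + 1/a) a⁴`. [folklore] -/
theorem codegree_mixing_arith {a q η₁ η₂ u t D C e : ℝ} (ha : 1 ≤ a) (hq0 : 0 ≤ q) (hq1 : q ≤ 1)
    (hη₁ : 0 ≤ η₁) (hη₂ : 0 ≤ η₂) (hu0 : 0 ≤ u) (hua : u ≤ a) (ht0 : 0 ≤ t) (hta : t ≤ a)
    (hD : |D - q * a * u| ≤ η₁ * a ^ 2) (hC : |C - q ^ 2 * a * (u * (u - 1))| ≤ η₂ * a ^ 3)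
    (hCS : (q * u * t - e) ^ 2 ≤ t * (a * (q * u) ^ 2 - 2 * (q * u) * D + (D + C))) :
    q * u * t - Real.sqrt (3 * η₁ + η₂ + 1 / a) * a ^ 2 ≤ e := by
  have ha0 : 0 < a := by linarith
  obtain ⟨hD1, hD2⟩ := abs_le.mp hD
  obtain ⟨-, hC2⟩ := abs_le.mp hC
  -- the exact identity: the `u²` terms cancel
  have hS : a * (q * u) ^ 2 - 2 * (q * u) * D + (D + C) =
      q * a * u * (1 - q) + (D - q * a * u) * (1 - 2 * (q * u)) +
        (C - q ^ 2 * a * (u * (u - 1))) := by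
    ring
  -- bounds for the three terms
  have h1 : q * a * u * (1 - q) ≤ a ^ 2 := by
    have hq : q * (1 - q) ≤ 1 := by nlinarith
    have hau : 0 ≤ a * u := mul_nonneg ha0.le hu0
    calc q * a * u * (1 - q) = q * (1 - q) * (a * u) := by ring
      _ ≤ 1 * (a * u) := mul_le_mul_of_nonneg_right hq hau
      _ ≤ a ^ 2 := by nlinarith
  have h2 : (D - q * a * u) * (1 - 2 * (q * u)) ≤ 3 * η₁ * a ^ 3 := by
    have hqu0 : 0 ≤ q * u := mul_nonneg hq0 hu0
    have hqu1 : q * u ≤ a := by nlinarith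
    have hy1 : 1 - 2 * (q * u) ≤ 1 + 2 * a := by linarith
    have hy2 : -(1 + 2 * a) ≤ 1 - 2 * (q * u) := by linarith
    have h : (D - q * a * u) * (1 - 2 * (q * u)) ≤ η₁ * a ^ 2 * (1 + 2 * a) := by
      nlinarith [mul_nonneg (sub_nonneg.mpr hD2) (sub_nonneg.mpr hy2),
        mul_nonneg (neg_le_iff_add_nonneg'.mp hD1) (sub_nonneg.mpr hy1)]
    have h' : η₁ * a ^ 2 * (1 + 2 * a) ≤ 3 * η₁ * a ^ 3 := by
      have : η₁ * a ^ 2 * (1 + 2 * a) ≤ η₁ * a ^ 2 * (3 * a) :=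
        mul_le_mul_of_nonneg_left (by linarith) (by positivity)
      linarith [this]
    linarith
  have hB : a * (q * u) ^ 2 - 2 * (q * u) * D + (D + C) ≤ a ^ 2 + (3 * η₁ + η₂) * a ^ 3 := by
    rw [hS]; linarith
  -- `(q u t − e)² ≤ (3 η₁ + η₂ + 1/a) a⁴ = (√(…) a²)²`
  have hK0 : 0 ≤ 3 * η₁ + η₂ + 1 / a := by positivity
  have hsq : (q * u * t - e) ^ 2 ≤ (Real.sqrt (3 * η₁ + η₂ + 1 / a) * a ^ 2) ^ 2 := by
    have h3 : t * (a * (q * u) ^ 2 - 2 * (q * u) * D + (D + C)) ≤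
        a * (a ^ 2 + (3 * η₁ + η₂) * a ^ 3) :=
      (mul_le_mul_of_nonneg_left hB ht0).trans
        (mul_le_mul_of_nonneg_right hta (by positivity))
    have h4 : a * (a ^ 2 + (3 * η₁ + η₂) * a ^ 3) = (3 * η₁ + η₂ + 1 / a) * a ^ 4 := by
      field_simp
      ring
    have h5 : (Real.sqrt (3 * η₁ + η₂ + 1 / a) * a ^ 2) ^ 2 = (3 * η₁ + η₂ + 1 / a) * a ^ 4 := by
      rw [mul_pow, Real.sq_sqrt hK0]
      ring
    rw [h5]
    linarith
  have := abs_le_of_sq_le_sq' hsq (by positivity)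
  linarith [this.2]

/-- **stub_codegreeMixing — the Cauchy–Schwarz codegree criterion.**  Let `H ⊆ Fin a × Fin a`
(`1 ≤ a`), `0 ≤ q ≤ 1`, `0 ≤ η₁, η₂`, with `∑_x |deg x − q a| ≤ η₁ a²` (row degrees) and
`∑_x ∑_{x' ≠ x} |codeg (x, x') − q² a| ≤ η₂ a³` (ordered-pair row codegrees).  Then for all row
sets `A` and column sets `B`,
`q #A #B − √(3 η₁ + η₂ + 1/a) a² ≤ e_H(A, B) = #{e ∈ H : e.1 ∈ A, e.2 ∈ B}`.
Proof: `codegree_mixing_arith` fed with `D = ∑_{x ∈ A} deg x`,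
`C = ∑_{x ∈ A} ∑_{x' ∈ A, x' ≠ x} codeg (x, x')` and the Cauchy–Schwarz estimate over the columns
(`card_filter_rect_eq_sum_cols`, `sq_sum_le_card_mul_sum_sq`, `sum_colDegIn_eq_sum_deg`,
`sum_colDegIn_sq`). [folklore] -/
theorem stub_codegreeMixing :
    ∀ (a : ℕ) (H : Finset (Fin a × Fin a)) (q η₁ η₂ : ℝ), 1 ≤ a → 0 ≤ q → q ≤ 1 → 0 ≤ η₁ → 0 ≤ η₂ →
      (∑ x : Fin a, |(((Finset.univ.filter fun y : Fin a => (x, y) ∈ H).card : ℕ) : ℝ) - q * a| ≤ η₁ * (a : ℝ) ^ 2) →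
      (∑ x : Fin a, ∑ x' ∈ Finset.univ.erase x,
          |(((Finset.univ.filter fun y : Fin a => (x, y) ∈ H ∧ (x', y) ∈ H).card : ℕ) : ℝ) - q ^ 2 * a| ≤
        η₂ * (a : ℝ) ^ 3) →
      ∀ A B : Finset (Fin a),
        q * A.card * B.card - Real.sqrt (3 * η₁ + η₂ + 1 / a) * (a : ℝ) ^ 2 ≤
          ((H.filter fun e => e.1 ∈ A ∧ e.2 ∈ B).card : ℝ) := by
  intro a H q η₁ η₂ ha hq0 hq1 hη₁ hη₂ hdeg hcodeg A B
  have hua : (A.card : ℝ) ≤ a := by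
    have h : A.card ≤ a := by simpa using A.card_le_univ
    exact_mod_cast h
  have hta : (B.card : ℝ) ≤ a := by
    have h : B.card ≤ a := by simpa using B.card_le_univ
    exact_mod_cast h
  refine codegree_mixing_arith
    (D := ∑ x ∈ A, ((Finset.univ.filter fun y : Fin a => (x, y) ∈ H).card : ℝ))
    (C := ∑ x ∈ A, ∑ x' ∈ A.erase x,
      ((Finset.univ.filter fun y : Fin a => (x, y) ∈ H ∧ (x', y) ∈ H).card : ℝ))
    (by exact_mod_cast ha) hq0 hq1 hη₁ hη₂ (Nat.cast_nonneg _) hua (Nat.cast_nonneg _) hta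
    ?_ ?_ ?_
  · -- `|D − q a #A| ≤ η₁ a²`: restrict the degree hypothesis to `A`
    have h1 : ∑ x ∈ A, ((Finset.univ.filter fun y : Fin a => (x, y) ∈ H).card : ℝ) -
          q * a * A.card =
        ∑ x ∈ A, (((Finset.univ.filter fun y : Fin a => (x, y) ∈ H).card : ℝ) - q * a) := by
      rw [Finset.sum_sub_distrib, Finset.sum_const, nsmul_eq_mul]
      ring
    rw [h1]
    calc |∑ x ∈ A, (((Finset.univ.filter fun y : Fin a => (x, y) ∈ H).card : ℝ) - q * a)|
        ≤ ∑ x ∈ A, |((Finset.univ.filter fun y : Fin a => (x, y) ∈ H).card : ℝ) - q * a| :=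
          Finset.abs_sum_le_sum_abs _ _
      _ ≤ ∑ x, |((Finset.univ.filter fun y : Fin a => (x, y) ∈ H).card : ℝ) - q * a| :=
          Finset.sum_le_univ_sum_of_nonneg fun x => abs_nonneg _
      _ ≤ η₁ * (a : ℝ) ^ 2 := hdeg
  · -- `|C − q² a #A (#A − 1)| ≤ η₂ a³`: restrict the codegree hypothesis to `x ∈ A`, `x' ∈ A \ {x}`
    have h1 : ∑ x ∈ A, ∑ x' ∈ A.erase x,
          ((Finset.univ.filter fun y : Fin a => (x, y) ∈ H ∧ (x', y) ∈ H).card : ℝ) -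
          q ^ 2 * a * (A.card * (A.card - 1)) =
        ∑ x ∈ A, ∑ x' ∈ A.erase x,
          (((Finset.univ.filter fun y : Fin a => (x, y) ∈ H ∧ (x', y) ∈ H).card : ℝ) -
            q ^ 2 * a) := by
      have h2 : ∀ x ∈ A, ∑ x' ∈ A.erase x,
          (((Finset.univ.filter fun y : Fin a => (x, y) ∈ H ∧ (x', y) ∈ H).card : ℝ) -
            q ^ 2 * a) =
          ∑ x' ∈ A.erase x,
            ((Finset.univ.filter fun y : Fin a => (x, y) ∈ H ∧ (x', y) ∈ H).card : ℝ) -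
            (A.card - 1) * (q ^ 2 * a) := by
        intro x hx
        rw [Finset.sum_sub_distrib, Finset.sum_const, nsmul_eq_mul,
          Finset.cast_card_erase_of_mem hx]
      rw [Finset.sum_congr rfl h2, Finset.sum_sub_distrib, Finset.sum_const, nsmul_eq_mul]
      ring
    rw [h1]
    calc |∑ x ∈ A, ∑ x' ∈ A.erase x,
          (((Finset.univ.filter fun y : Fin a => (x, y) ∈ H ∧ (x', y) ∈ H).card : ℝ) -
            q ^ 2 * a)|
        ≤ ∑ x ∈ A, |∑ x' ∈ A.erase x,
          (((Finset.univ.filter fun y : Fin a => (x, y) ∈ H ∧ (x', y) ∈ H).card : ℝ) -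
            q ^ 2 * a)| :=
          Finset.abs_sum_le_sum_abs _ _
      _ ≤ ∑ x ∈ A, ∑ x' ∈ A.erase x,
          |((Finset.univ.filter fun y : Fin a => (x, y) ∈ H ∧ (x', y) ∈ H).card : ℝ) -
            q ^ 2 * a| :=
          Finset.sum_le_sum fun x _ => Finset.abs_sum_le_sum_abs _ _
      _ ≤ ∑ x ∈ A, ∑ x' ∈ Finset.univ.erase x,
          |((Finset.univ.filter fun y : Fin a => (x, y) ∈ H ∧ (x', y) ∈ H).card : ℝ) -
            q ^ 2 * a| :=
          Finset.sum_le_sum fun x _ =>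
            Finset.sum_le_sum_of_subset_of_nonneg
              (Finset.erase_subset_erase x (Finset.subset_univ A)) fun _ _ _ => abs_nonneg _
      _ ≤ ∑ x, ∑ x' ∈ Finset.univ.erase x,
          |((Finset.univ.filter fun y : Fin a => (x, y) ∈ H ∧ (x', y) ∈ H).card : ℝ) -
            q ^ 2 * a| :=
          Finset.sum_le_univ_sum_of_nonneg fun x => Finset.sum_nonneg fun _ _ => abs_nonneg _
      _ ≤ η₂ * (a : ℝ) ^ 3 := hcodeg
  · -- Cauchy–Schwarz over the columns
    -- `e = ∑_{b ∈ B} d_A(b)`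
    have he : ((H.filter fun e => e.1 ∈ A ∧ e.2 ∈ B).card : ℝ) =
        ∑ b ∈ B, ((A.filter fun x => (x, b) ∈ H).card : ℝ) := by
      exact_mod_cast card_filter_rect_eq_sum_cols H A B
    -- `∑_b d_A(b) = D`, `∑_b d_A(b)² = D + C`
    have hD : ∑ b : Fin a, ((A.filter fun x => (x, b) ∈ H).card : ℝ) =
        ∑ x ∈ A, ((Finset.univ.filter fun y : Fin a => (x, y) ∈ H).card : ℝ) := by
      exact_mod_cast sum_colDegIn_eq_sum_deg H A
    have hQ : ∑ b : Fin a, ((A.filter fun x => (x, b) ∈ H).card : ℝ) ^ 2 =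
        ∑ x ∈ A, ((Finset.univ.filter fun y : Fin a => (x, y) ∈ H).card : ℝ) +
          ∑ x ∈ A, ∑ x' ∈ A.erase x,
            ((Finset.univ.filter fun y : Fin a => (x, y) ∈ H ∧ (x', y) ∈ H).card : ℝ) := by
      exact_mod_cast sum_colDegIn_sq H A
    -- `q #A #B − e = ∑_{b ∈ B} (q #A − d_A(b))`
    have hdiff : q * A.card * B.card - ((H.filter fun e => e.1 ∈ A ∧ e.2 ∈ B).card : ℝ) =
        ∑ b ∈ B, (q * A.card - ((A.filter fun x => (x, b) ∈ H).card : ℝ)) := by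
      rw [he, Finset.sum_sub_distrib, Finset.sum_const, nsmul_eq_mul]
      ring
    -- `∑_b (q #A − d_A(b))² = a (q #A)² − 2 (q #A) D + (D + C)`
    have hexp : ∑ b : Fin a, (q * A.card - ((A.filter fun x => (x, b) ∈ H).card : ℝ)) ^ 2 =
        a * (q * A.card) ^ 2 - 2 * (q * A.card) *
          ∑ x ∈ A, ((Finset.univ.filter fun y : Fin a => (x, y) ∈ H).card : ℝ) +
          (∑ x ∈ A, ((Finset.univ.filter fun y : Fin a => (x, y) ∈ H).card : ℝ) +
            ∑ x ∈ A, ∑ x' ∈ A.erase x,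
              ((Finset.univ.filter fun y : Fin a => (x, y) ∈ H ∧ (x', y) ∈ H).card : ℝ)) := by
      rw [← hQ, ← hD, Finset.mul_sum]
      simp only [sub_sq, Finset.sum_add_distrib, Finset.sum_sub_distrib, Finset.sum_const,
        Finset.card_univ, Fintype.card_fin, nsmul_eq_mul]
    rw [hdiff, ← hexp]
    calc (∑ b ∈ B, (q * A.card - ((A.filter fun x => (x, b) ∈ H).card : ℝ))) ^ 2
        ≤ B.card * ∑ b ∈ B, (q * A.card - ((A.filter fun x => (x, b) ∈ H).card : ℝ)) ^ 2 :=
          sq_sum_le_card_mul_sum_sq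
      _ ≤ B.card * ∑ b : Fin a, (q * A.card - ((A.filter fun x => (x, b) ∈ H).card : ℝ)) ^ 2 :=
          mul_le_mul_of_nonneg_left (Finset.sum_le_univ_sum_of_nonneg fun b => sq_nonneg _)
            (Nat.cast_nonneg _)

end Summit.ValiantsHypothesis.ValiantsHypothesis.Theorems.DivisionGap.PerMultiplesHard.CodegreeMixing
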